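import Mathlib
import Summits.Ventures.PercRepro.TriangleCapDenseStabilityReduction

/-!
# PercRepro — ONE BELOW THE DIAGONAL, TRIANGLE-FREE: `K_{a,k−a}` minus an edge is extremal (p3, gen 34; part 32)

TriangleCapDenseStabilityReduction gives, for a triangle-free graph with `m` edges on `k` vertices where no
complete bipartite spanning graph has `m` edges, `2·Σ_v C(d(v), 2) ≤ (m − 1)(k − 2)`.  This module supplies the
matching witness: `K_{a,k−a}` minus one edge (`bipMinus k a`, the edge `0 — a` removed), triangle-free AND
`K₄⁻`-free, with `a(k−a) − 1` edges and `2·cherries = (a(k−a) − 2)(k − 2)`.  Hence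

* **`one_below_diagonal_cliqueFree_exact`** — for `1 ≤ a < k` such that `m = a(k−a) − 1` is not of the form
  `a′(k − a′)`, the triangle-free cherry maximum at `(k, m)` IS `(m − 1)(k − 2)/2` (bound and witness on `Fin k`);
* `k4mFree_of_le` — `K₄⁻`-freeness passes to subgraphs (used for the witness; the `K₄⁻`-free maximum at these
  cells is the dense-corner conjecture of P3-TRIANGLE-CAP.md §10as(c2), open beyond the triangle-free class).

Axioms: standard.
-/

namespace PercRepro

namespace TriangleCap

namespace C047

open Finset

variable {V : Type*} [Fintype V]

omit [Fintype V] in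
/-- `K₄⁻`-freeness passes to subgraphs. -/
theorem k4mFree_of_le (D D' : SimpleGraph V) [DecidableRel D.Adj] [DecidableRel D'.Adj] (h : D ≤ D')
    (hK : K4mFree D') : K4mFree D := by
  intro S hS
  refine le_trans ?_ (hK S hS)
  unfold adjPairs
  apply card_le_card
  intro p hp
  rw [mem_filter] at hp ⊢
  exact ⟨hp.1, h hp.2⟩

/-- `K_{a, n−a}` on `Fin n` minus the edge between the left vertex `0` and the right vertex `a`. -/
def bipMinus (n a : ℕ) : SimpleGraph (Fin n) where
  Adj i j := Xor (i.val < a) (j.val < a) ∧ ¬ ((i.val = 0 ∧ j.val = a) ∨ (i.val = a ∧ j.val = 0))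
  symm := ⟨fun i j h => by
    obtain ⟨h1, h2⟩ := h
    refine ⟨?_, fun h' => h2 ?_⟩
    · rcases h1 with ⟨ha, hb⟩ | ⟨ha, hb⟩
      · exact Or.inr ⟨ha, hb⟩
      · exact Or.inl ⟨ha, hb⟩
    · rcases h' with ⟨ha, hb⟩ | ⟨ha, hb⟩
      · exact Or.inr ⟨hb, ha⟩
      · exact Or.inl ⟨hb, ha⟩⟩
  loopless := ⟨fun i h => by
    rcases h.1 with ⟨h1, h2⟩ | ⟨h1, h2⟩ <;> exact h2 h1⟩

/-- Adjacency in `bipMinus n a` is decidable. -/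
instance decidableRelBipMinus (n a : ℕ) : DecidableRel (bipMinus n a).Adj :=
  fun i j => inferInstanceAs (Decidable (Xor (i.val < a) (j.val < a) ∧
    ¬ ((i.val = 0 ∧ j.val = a) ∨ (i.val = a ∧ j.val = 0))))

/-- Adjacency in `bipMinus n a`. -/
theorem bipMinus_adj (n a : ℕ) (i j : Fin n) : (bipMinus n a).Adj i j ↔
    Xor (i.val < a) (j.val < a) ∧ ¬ ((i.val = 0 ∧ j.val = a) ∨ (i.val = a ∧ j.val = 0)) := Iff.rfl

/-- `bipMinus n a` is a subgraph of `K_{a, n−a}`. -/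
theorem bipMinus_le_bip (n a : ℕ) : bipMinus n a ≤ bip n a := fun _ _ h => h.1

/-- `bipMinus n a` is `K₄⁻`-free. -/
theorem k4mFree_bipMinus (n a : ℕ) : K4mFree (bipMinus n a) :=
  k4mFree_of_le _ _ (bipMinus_le_bip n a) (k4mFree_bip n a)

/-- `bipMinus n a` is triangle-free. -/
theorem cliqueFree_bipMinus (n a : ℕ) : (bipMinus n a).CliqueFree 3 := by
  intro S hS
  rw [SimpleGraph.is3Clique_iff] at hS
  obtain ⟨x, y, z, hxy, hxz, hyz, -⟩ := hS
  exact cliqueFree_bip n a {x, y, z} (SimpleGraph.is3Clique_triple_iff.mpr ⟨hxy.1, hxz.1, hyz.1⟩)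

/-- The neighbourhood of a vertex other than `0` and `a` is unchanged. -/
theorem filter_adj_bipMinus_of_ne (n a : ℕ) (v : Fin n) (h0 : v.val ≠ 0) (ha : v.val ≠ a) :
    univ.filter (fun w => (bipMinus n a).Adj v w) = univ.filter (fun w => (bip n a).Adj v w) := by
  apply filter_congr
  intro w _
  rw [bipMinus_adj, bip_adj]
  constructor
  · exact fun h => h.1
  · intro h
    refine ⟨h, fun h' => ?_⟩
    rcases h' with ⟨h1, _⟩ | ⟨h1, _⟩
    · exact h0 h1
    · exact ha h1

/-- The neighbourhood of the left vertex `0` loses the vertex `a`. -/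
theorem filter_adj_bipMinus_zero (n a : ℕ) (ha : 1 ≤ a) (han : a < n) (v : Fin n) (hv : v.val = 0) :
    univ.filter (fun w => (bipMinus n a).Adj v w) =
      (univ.filter (fun w => (bip n a).Adj v w)).erase ⟨a, han⟩ := by
  ext w
  rw [mem_erase, mem_filter, mem_filter, bipMinus_adj, bip_adj]
  simp only [mem_univ, true_and]
  constructor
  · rintro ⟨h1, h2⟩
    refine ⟨fun h => h2 (Or.inl ⟨hv, by rw [h]⟩), h1⟩
  · rintro ⟨h1, h2⟩
    refine ⟨h2, fun h => ?_⟩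
    rcases h with ⟨_, h4⟩ | ⟨h3, _⟩
    · exact h1 (Fin.ext h4)
    · omega

/-- The neighbourhood of the right vertex `a` loses the vertex `0`. -/
theorem filter_adj_bipMinus_a (n a : ℕ) (ha : 1 ≤ a) (han : a < n) (v : Fin n) (hv : v.val = a) :
    univ.filter (fun w => (bipMinus n a).Adj v w) =
      (univ.filter (fun w => (bip n a).Adj v w)).erase ⟨0, by omega⟩ := by
  ext w
  rw [mem_erase, mem_filter, mem_filter, bipMinus_adj, bip_adj]
  simp only [mem_univ, true_and]
  constructor
  · rintro ⟨h1, h2⟩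
    refine ⟨fun h => h2 (Or.inr ⟨hv, by rw [h]⟩), h1⟩
  · rintro ⟨h1, h2⟩
    refine ⟨h2, fun h => ?_⟩
    rcases h with ⟨h3, _⟩ | ⟨_, h4⟩
    · omega
    · exact h1 (Fin.ext h4)

/-- The degrees of `bipMinus n a`: `n − a − 1` at `0`, `a − 1` at `a`, as in `K_{a, n−a}` elsewhere. -/
theorem deg_bipMinus (n a : ℕ) (ha : 1 ≤ a) (han : a < n) (v : Fin n) :
    deg (bipMinus n a) v = if v.val = 0 then n - a - 1 else if v.val = a then a - 1 else deg (bip n a) v := by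
  unfold deg
  by_cases h0 : v.val = 0
  · rw [if_pos h0, filter_adj_bipMinus_zero n a ha han v h0, card_erase_of_mem]
    · have := deg_bip_of_lt n a (by omega) v (by omega)
      unfold deg at this
      rw [this]
    · rw [mem_filter, bip_adj]
      exact ⟨mem_univ _, Or.inl ⟨by omega, by simp⟩⟩
  · rw [if_neg h0]
    by_cases hva : v.val = a
    · rw [if_pos hva, filter_adj_bipMinus_a n a ha han v hva, card_erase_of_mem]
      · have := deg_bip_of_not_lt n a (by omega) v (by omega)
        unfold deg at this
        rw [this]
      · rw [mem_filter, bip_adj]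
        exact ⟨mem_univ _, Or.inr ⟨by simp; omega, by omega⟩⟩
    · rw [if_neg hva, filter_adj_bipMinus_of_ne n a v h0 hva]

/-- The vertex `0` of `Fin n`. -/
theorem sum_bipMinus_split (n a : ℕ) (ha : 1 ≤ a) (han : a < n) (f : Fin n → ℕ) :
    ∑ v, f v = f ⟨0, by omega⟩ + f ⟨a, han⟩ + ∑ v ∈ (univ.erase ⟨0, by omega⟩).erase ⟨a, han⟩, f v := by
  have h1 := add_sum_erase (univ : Finset (Fin n)) f (mem_univ ⟨0, by omega⟩)
  have h2 := add_sum_erase (univ.erase ⟨0, by omega⟩) f (a := ⟨a, han⟩)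
    (by rw [mem_erase]; exact ⟨fun h => by have := Fin.mk.inj_iff.mp h; omega, mem_univ _⟩)
  omega

/-- `Σ_v d(v)² = a(n−a)·n` on `K_{a, n−a}`. -/
theorem sum_deg_sq_bip (n a : ℕ) (h : a ≤ n) :
    ∑ v, deg (bip n a) v * deg (bip n a) v = a * (n - a) * n := by
  have h1 := two_mul_cherries_add (bip n a)
  have h2 := mantel_eq_bip n a h
  rw [sum_deg_eq] at h1
  rw [card_edges_bip n a h] at h1 h2
  omega

/-- On `bipMinus n a`: `Σ_v d(v) = 2(a(n−a) − 1)` and `Σ_v d(v)² = a(n−a)n − 2n + 2`. -/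
theorem sums_bipMinus (n a : ℕ) (ha : 1 ≤ a) (han : a < n) :
    ∑ v, deg (bipMinus n a) v + 2 = 2 * (a * (n - a)) ∧
      ∑ v, deg (bipMinus n a) v * deg (bipMinus n a) v + 2 * n = a * (n - a) * n + 2 := by
  have hd := deg_bipMinus n a ha han
  have h0 : deg (bipMinus n a) ⟨0, by omega⟩ = n - a - 1 := by rw [hd]; simp
  have hA : deg (bipMinus n a) ⟨a, han⟩ = a - 1 := by
    rw [hd]; simp only [if_neg (show a ≠ 0 by omega)]; simp
  have hrest : ∀ v ∈ (univ.erase ⟨0, by omega⟩).erase ⟨a, han⟩,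
      deg (bipMinus n a) v = deg (bip n a) v := by
    intro v hv
    rw [mem_erase, mem_erase] at hv
    rw [hd, if_neg, if_neg]
    · intro h; exact hv.1 (Fin.ext h)
    · intro h; exact hv.2.1 (Fin.ext h)
  have hb0 : deg (bip n a) ⟨0, by omega⟩ = n - a := deg_bip_of_lt n a (by omega) _ (by simp; omega)
  have hbA : deg (bip n a) ⟨a, han⟩ = a := deg_bip_of_not_lt n a (by omega) _ (by simp)
  -- the degree sum
  have s1 := sum_bipMinus_split n a ha han (fun v => deg (bipMinus n a) v)
  have s1' := sum_bipMinus_split n a ha han (fun v => deg (bip n a) v)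
  have e1 : ∑ v ∈ (univ.erase ⟨0, by omega⟩).erase ⟨a, han⟩, deg (bipMinus n a) v =
      ∑ v ∈ (univ.erase ⟨0, by omega⟩).erase ⟨a, han⟩, deg (bip n a) v :=
    sum_congr rfl (fun v hv => hrest v hv)
  have sb := sum_deg_bip n a (by omega)
  -- the square sum
  have s2 := sum_bipMinus_split n a ha han (fun v => deg (bipMinus n a) v * deg (bipMinus n a) v)
  have s2' := sum_bipMinus_split n a ha han (fun v => deg (bip n a) v * deg (bip n a) v)
  have e2 : ∑ v ∈ (univ.erase ⟨0, by omega⟩).erase ⟨a, han⟩, deg (bipMinus n a) v * deg (bipMinus n a) v =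
      ∑ v ∈ (univ.erase ⟨0, by omega⟩).erase ⟨a, han⟩, deg (bip n a) v * deg (bip n a) v :=
    sum_congr rfl (fun v hv => by rw [hrest v hv])
  have sq := sum_deg_sq_bip n a (by omega)
  simp only at s1 s1' s2 s2'
  rw [h0, hA, e1] at s1
  rw [hb0, hbA] at s1'
  rw [h0, hA, e2] at s2
  rw [hb0, hbA] at s2'
  obtain ⟨b, hb⟩ : ∃ b, n = a + 1 + b := ⟨n - a - 1, by omega⟩
  obtain ⟨c, hc⟩ : ∃ c, a = c + 1 := ⟨a - 1, by omega⟩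
  subst hb
  subst hc
  have en1 : c + 1 + 1 + b - (c + 1) - 1 = b := by omega
  have en : c + 1 + 1 + b - (c + 1) = b + 1 := by omega
  have ec : c + 1 - 1 = c := by omega
  rw [en1, ec] at s1 s2
  rw [en] at s1' s2' sb sq ⊢
  have x1 : (b + 1) * (b + 1) = b * b + 2 * b + 1 := by ring
  have x2 : (c + 1) * (c + 1) = c * c + 2 * c + 1 := by ring
  rw [x1, x2] at s2'
  constructor
  · omega
  · omega

/-- `bipMinus n a` has `a(n−a) − 1` edges. -/
theorem card_edges_bipMinus (n a : ℕ) (ha : 1 ≤ a) (han : a < n) :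
    (bipMinus n a).edgeFinset.card + 1 = a * (n - a) := by
  have h := (sums_bipMinus n a ha han).1
  rw [sum_deg_eq] at h
  omega

/-- `2·cherries(bipMinus n a) = (a(n−a) − 2)(n − 2)`: the witness value one below the diagonal. -/
theorem two_mul_cherries_bipMinus (n a : ℕ) (ha : 1 ≤ a) (han : a < n) :
    2 * cherries (bipMinus n a) + 2 * (n - 2) = a * (n - a) * (n - 2) := by
  have h1 := two_mul_cherries_add (bipMinus n a)
  have ⟨h2, h3⟩ := sums_bipMinus n a ha han
  have hn : 2 ≤ n := by omega
  obtain ⟨j, hj⟩ := Nat.exists_eq_add_of_le hn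
  subst hj
  have e : 2 + j - 2 = j := by omega
  rw [e]
  nlinarith [h1, h2, h3]

/-- **ONE BELOW THE DIAGONAL, TRIANGLE-FREE, EXACT:** for `1 ≤ a < k` with `m = a(k−a) − 1` not of the form
`a′(k − a′)`, the maximum of `2·Σ_v C(d(v), 2)` over triangle-free graphs with `m` edges on `k` vertices is
`(m − 1)(k − 2)`, attained by `K_{a,k−a}` minus an edge (which is also `K₄⁻`-free). -/
theorem one_below_diagonal_cliqueFree_exact (k a : ℕ) (ha : 1 ≤ a) (hak : a < k)
    (hm : ∀ a', a' ≤ k → a * (k - a) - 1 ≠ a' * (k - a')) :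
    (∀ (D : SimpleGraph (Fin k)) [DecidableRel D.Adj], D.CliqueFree 3 →
        D.edgeFinset.card = a * (k - a) - 1 → 2 * cherries D ≤ (a * (k - a) - 2) * (k - 2)) ∧
      ∃ (D : SimpleGraph (Fin k)) (_ : DecidableRel D.Adj), D.CliqueFree 3 ∧ K4mFree D ∧
        D.edgeFinset.card = a * (k - a) - 1 ∧ 2 * cherries D = (a * (k - a) - 2) * (k - 2) := by
  refine ⟨fun D _ hfree hD => ?_, bipMinus k a, inferInstance, cliqueFree_bipMinus k a,
    k4mFree_bipMinus k a, by have := card_edges_bipMinus k a ha hak; omega, ?_⟩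
  · have h := cherries_le_of_cliqueFree_off_diagonal D hfree (by
      intro a' ha' h'
      rw [Fintype.card_fin] at ha' h'
      rw [hD] at h'
      exact hm a' ha' h')
    rw [Fintype.card_fin, hD] at h
    have hka : 2 ≤ a * (k - a) := by
      have h0 := hm 0 (Nat.zero_le _)
      simp only [Nat.zero_mul] at h0
      omega
    obtain ⟨m, hmm⟩ : ∃ m, a * (k - a) = m + 2 := ⟨a * (k - a) - 2, by omega⟩
    rw [hmm] at h ⊢
    have e1 : m + 2 - 1 = m + 1 := by omega
    have e2 : m + 2 - 2 = m := by omega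
    rw [e1] at h
    rw [e2]
    obtain ⟨t, ht⟩ : ∃ t, k = t + 2 := ⟨k - 2, by omega⟩
    have e3 : k - 2 = t := by omega
    rw [e3] at h ⊢
    have hk : (m + 1) * k = m * t + t + 2 * (m + 1) := by rw [ht]; ring
    rw [hk] at h
    omega
  · have h := two_mul_cherries_bipMinus k a ha hak
    have hka : 2 ≤ a * (k - a) := by
      have h0 := hm 0 (Nat.zero_le _)
      simp only [Nat.zero_mul] at h0
      omega
    obtain ⟨m, hmm⟩ : ∃ m, a * (k - a) = m + 2 := ⟨a * (k - a) - 2, by omega⟩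
    rw [hmm] at h ⊢
    have e2 : m + 2 - 2 = m := by omega
    rw [e2]
    obtain ⟨t, ht⟩ : ∃ t, k = t + 2 := ⟨k - 2, by omega⟩
    have e3 : k - 2 = t := by omega
    rw [e3] at h ⊢
    have hk : (m + 2) * t = m * t + 2 * t := by ring
    rw [hk] at h
    omega

end C047

end TriangleCap

end PercRepro
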